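import Literature.AlgebraicGeometry.Resolution.ResolutionOfSingularities
import Literature.AlgebraicGeometry.Resolution.RegularLocalRingsFlatDescent
import Literature.AlgebraicGeometry.Morphisms.ReducedOfFlat
import Mathlib.AlgebraicGeometry.Morphisms.Flat
import Mathlib.AlgebraicGeometry.Morphisms.UniversallyClosed
import Mathlib.AlgebraicGeometry.IdealSheaf.Subscheme
import Mathlib.AlgebraicGeometry.Noetherian
import HarnessLib

/-!
# `PAlteration.Assembly` (stmt-ResolutionOfSingularities-0553): cartesian squares and flat descent, generic tools

Route `ResolutionOfSingularities/pAlteration`, item `Assembly` (stmt-0553); helper file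
(`--supports`). Generic scheme lemmas for the descent step of Theorem B:

* `IsPullback.exists_restrict` — a cartesian square `P = X ×_Z Y` restricts, over an open
  `W ⊆ Z`, to a cartesian square of the restricted morphisms;
* `surjective_toImage_of_isClosed_range` — a quasi-compact morphism with closed range maps onto
  its scheme-theoretic image;
* `isRegular_of_flat_surjective` — regularity descends along a flat surjective morphism onto a
  locally Noetherian scheme (Matsumura 23.7 (i) on stalks);
* `isIntegral_of_flat_surjective` — integrality descends along a flat surjective morphism.
-/

-- single-problem summit: the doubled namespace component `ResolutionOfSingularities` is forced
set_option linter.dupNamespace false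

noncomputable section

open CategoryTheory CategoryTheory.Limits AlgebraicGeometry TopologicalSpace Topology

open Literature.AlgebraicGeometry.Resolution

namespace Summit.ResolutionOfSingularities.ResolutionOfSingularities.Theorems

universe u

/-! ## Restricting a cartesian square over an open of the base -/

/-- **Cartesian squares restrict over opens of the base.** If `P = X ×_Z Y` (square
`fst, snd, f, g`) and `W ⊆ Z` is open, then `fst⁻¹ f⁻¹ W = (f⁻¹ W) ×_W (g⁻¹ W)` via the
restricted morphisms `fst ∣ f⁻¹W`, the restriction of `snd`, `f ∣ W` and `g ∣ W`. [folklore] -/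
theorem IsPullback.exists_restrict {P X Y Z : Scheme.{u}} {fst : P ⟶ X} {snd : P ⟶ Y}
    {f : X ⟶ Z} {g : Y ⟶ Z} (h : IsPullback fst snd f g) (W : Z.Opens) :
    ∃ sndW : (fst ⁻¹ᵁ (f ⁻¹ᵁ W) : Scheme.{u}) ⟶ (g ⁻¹ᵁ W : Scheme.{u}),
      sndW ≫ (g ⁻¹ᵁ W).ι = (fst ⁻¹ᵁ (f ⁻¹ᵁ W)).ι ≫ snd ∧
        IsPullback (fst ∣_ (f ⁻¹ᵁ W)) sndW (f ∣_ W) (g ∣_ W) := by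
  have hrange : Set.range ((fst ⁻¹ᵁ (f ⁻¹ᵁ W)).ι ≫ snd).base ⊆ Set.range (g ⁻¹ᵁ W).ι.base := by
    rintro _ ⟨x, rfl⟩
    rw [Scheme.Opens.range_ι]
    show g.base (snd.base ((fst ⁻¹ᵁ (f ⁻¹ᵁ W)).ι.base x)) ∈ W
    rw [← Scheme.Hom.comp_apply, ← h.w, Scheme.Hom.comp_apply]
    exact x.2
  let sndW := IsOpenImmersion.lift (g ⁻¹ᵁ W).ι ((fst ⁻¹ᵁ (f ⁻¹ᵁ W)).ι ≫ snd) hrange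
  have hsndW : sndW ≫ (g ⁻¹ᵁ W).ι = (fst ⁻¹ᵁ (f ⁻¹ᵁ W)).ι ≫ snd := IsOpenImmersion.lift_fac _ _ _
  refine ⟨sndW, hsndW, ?_⟩
  have s2 := (isPullback_morphismRestrict fst (f ⁻¹ᵁ W)).paste_vert h
  rw [← morphismRestrict_ι, ← hsndW] at s2
  have p : sndW ≫ (g ∣_ W) = (fst ∣_ (f ⁻¹ᵁ W)) ≫ (f ∣_ W) := by
    rw [← cancel_mono W.ι, Category.assoc, Category.assoc, morphismRestrict_ι, morphismRestrict_ι,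
      ← Category.assoc, hsndW, Category.assoc, ← h.w, ← Category.assoc, ← morphismRestrict_ι,
      Category.assoc]
  exact (IsPullback.of_right s2.flip p (isPullback_morphismRestrict g W).flip).flip

/-! ## The scheme-theoretic image of a morphism with closed range -/

/-- A quasi-compact morphism with closed range maps ONTO its scheme-theoretic image.
[folklore] -/
theorem surjective_toImage_of_isClosed_range {X Y : Scheme.{u}} (f : X ⟶ Y) [QuasiCompact f]
    (hc : IsClosed (Set.range f.base)) : Surjective f.toImage := by
  refine ⟨fun y => ?_⟩
  have hy : f.imageι.base y ∈ Set.range f.base := by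
    rw [← hc.closure_eq, ← Scheme.Hom.support_ker]
    change f.ker.subschemeι.base y ∈ (f.ker.support : Set Y)
    rw [← Scheme.IdealSheafData.range_subschemeι]
    exact ⟨y, rfl⟩
  obtain ⟨x, hx⟩ := hy
  refine ⟨x, f.imageι.isClosedEmbedding.injective ?_⟩
  rw [← Scheme.Hom.comp_apply, Scheme.Hom.toImage_imageι, hx]

/-- A universally closed morphism maps onto its scheme-theoretic image. [folklore] -/
theorem surjective_toImage_of_universallyClosed {X Y : Scheme.{u}} (f : X ⟶ Y)
    [UniversallyClosed f] : Surjective f.toImage :=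
  surjective_toImage_of_isClosed_range f f.isClosedMap.isClosed_range

/-! ## Descent along flat surjective morphisms -/

/-- **Regularity descends along flat surjective morphisms** onto a locally Noetherian scheme
(Matsumura, Thm. 23.7 (i), applied to the flat local stalk maps). [folklore] -/
theorem isRegular_of_flat_surjective {X Y : Scheme.{u}} (e : X ⟶ Y) [Flat e] [Surjective e]
    [IsLocallyNoetherian Y] (hX : Scheme.IsRegular X) : Scheme.IsRegular Y := by
  intro y
  obtain ⟨x, rfl⟩ := e.surjective y
  haveI := hX x
  exact IsRegularLocalRing.of_flat_ringHom (e.stalkMap x).hom (Flat.stalkMap e x)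

/-- **Integrality descends along flat surjective morphisms.** [folklore] -/
theorem isIntegral_of_flat_surjective {X Y : Scheme.{u}} (e : X ⟶ Y) [Flat e] [Surjective e]
    [IsIntegral X] : IsIntegral Y :=
  haveI : IsReduced Y := Literature.AlgebraicGeometry.Morphisms.isReduced_of_flat_of_surjective e
  haveI : IrreducibleSpace Y := e.surjective.irreducibleSpace e.continuous
  isIntegral_of_irreducibleSpace_of_isReduced Y

/-- Irreducibility passes along a surjective morphism. [folklore] -/
theorem irreducibleSpace_of_surjective {X Y : Scheme.{u}} (e : X ⟶ Y) [Surjective e]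
    [IrreducibleSpace X] : IrreducibleSpace Y :=
  e.surjective.irreducibleSpace e.continuous

end Summit.ResolutionOfSingularities.ResolutionOfSingularities.Theorems

end
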